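import Mathlib.Algebra.MvPolynomial.NoZeroDivisors
import Literature.Computability.AlgebraicComplexity.GKSS19ShiftCalculus
import HarnessLib

/-!
# Guo–Kumar–Saptharishi–Solomon 2019, the low-variable case of Theorem 1.6: for non-constant
# `P`, no nonzero `Q(x_0, x_1)` annihilates `(Δ_0(P), Δ_1(P))`

Cell `val-lit`, seat t19 (literature-prover); the last brick of the discharge programme of
`GKSS2019_mainThm` (v2, erratum A34). THEOREM-ONLY (no definitions, no named facts); nothing here
bears on `VP ≠ VNP`, which is NOT proved.

Source: Z. Guo, M. Kumar, R. Saptharishi, N. Solomon, *Derandomization from algebraic hardness*,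
SIAM J. Comput. 51 (2022) = arXiv:1905.00091 [GuoKumarSaptharishiSolomon2019]. The printed proof
of Thm 1.6 (§3) bounds the reconstruction by `poly(s, d, D, n^k)`; for `n = 1` this cannot absorb
the `k` interpolation points, and the statement is instead true for the elementary reason recorded
here (Obs. 22's grading: `Δ_0(P) = P(z)` has `y`-degree `0`, `Δ_1(P) = Σ_j y_j ∂_j P` is a nonzero
linear form in `y` when `P` is non-constant and `char F = 0`, and `P` is transcendental over `F`)
— cf. §2.4 Def. 9 and Obs. 22 (held text `paper:arxiv-1905.00091`, p0010.txt:L38–L55) and the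
remark "(since `P` depends on at least 1 variable)" (p0011.txt:L13).

## What is here

* `aeval_ne_zero_of_totalDegree_pos` — a non-constant `P ∈ F[z]` is transcendental over `F`;
* `homogeneousComponent_one_shiftR_ne_zero` — `Δ_1(P) ≠ 0` for non-constant `P` (`char F = 0`;
  Euler's identity of `AC/GKSS19ShiftCalculus`);
* **`lowVariables`** — for `m ≤ 1` and non-constant `P`: `Q(Δ_0(P), …, Δ_m(P)) = 0 ⇒ Q = 0`.

## References
* [GuoKumarSaptharishiSolomon2019] arXiv:1905.00091, §2.4 Def. 9 / Obs. 22 (p0010.txt:L38–55),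
  §3 (p0011.txt:L13).
-/

noncomputable section

open MvPolynomial

namespace Literature.Computability.AlgebraicComplexity

namespace GKSS2019

universe u

variable {F : Type u} [Field F] {k : ℕ}

/-! ### Transcendence of a non-constant polynomial -/

/-- Powers of `P` have total degree `i · deg P` (domain). [cite: GuoKumarSaptharishiSolomon2019, §3 (arXiv p0011.txt:L13), "since P depends on at least 1 variable"] -/
theorem totalDegree_pow_eq (P : MvPolynomial (Fin k) F) (hP : P ≠ 0) (i : ℕ) :
    (P ^ i).totalDegree = i * P.totalDegree := by
  induction i with
  | zero => simp
  | succ i ih =>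
    rw [pow_succ, totalDegree_mul_of_isDomain (pow_ne_zero i hP) hP, ih]
    ring

/-- **A non-constant polynomial is transcendental**: `q(P) ≠ 0` for every nonzero `q ∈ F[X]` when
`deg P ≥ 1`. [cite: GuoKumarSaptharishiSolomon2019, §3 (arXiv p0011.txt:L13)] -/
theorem aeval_ne_zero_of_totalDegree_pos {P : MvPolynomial (Fin k) F} (hP : 0 < P.totalDegree)
    {q : Polynomial F} (hq : q ≠ 0) : Polynomial.aeval P q ≠ 0 := by
  classical
  have hP0 : P ≠ 0 := by rintro rfl; simp at hP
  -- split off the leading term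
  set r := q.natDegree with hr
  have hsplit : Polynomial.aeval P q =
      C (q.coeff r) * P ^ r + Polynomial.aeval P (q.eraseLead) := by
    conv_lhs => rw [← Polynomial.eraseLead_add_C_mul_X_pow q]
    rw [map_add, map_mul, map_pow, Polynomial.aeval_C, Polynomial.aeval_X, MvPolynomial.algebraMap_eq,
      add_comm, Polynomial.leadingCoeff, ← hr]
  have hlead : (C (q.coeff r) * P ^ r).totalDegree = r * P.totalDegree := by
    have hc : q.coeff r ≠ 0 := by rw [hr]; exact Polynomial.leadingCoeff_ne_zero.mpr hq
    rw [totalDegree_mul_of_isDomain (by rwa [Ne, C_eq_zero]) (pow_ne_zero r hP0), totalDegree_C,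
      zero_add, totalDegree_pow_eq P hP0]
  by_cases hr0 : r = 0
  · -- constant `q`
    have hq' : q = Polynomial.C (q.coeff 0) := Polynomial.eq_C_of_natDegree_eq_zero (hr ▸ hr0)
    rw [hq', Polynomial.aeval_C, MvPolynomial.algebraMap_eq, Ne, C_eq_zero]
    intro h0
    apply hq
    rw [hq', h0, map_zero]
  · -- the rest has smaller degree
    have hrest : (Polynomial.aeval P q.eraseLead).totalDegree < (C (q.coeff r) * P ^ r).totalDegree := by
      rw [hlead]
      rw [Polynomial.aeval_eq_sum_range' (n := r) (by
        have := Polynomial.eraseLead_natDegree_le q; rw [← hr] at this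
        rcases Nat.lt_or_ge q.eraseLead.natDegree r with h | h
        · exact h
        · exfalso
          have h2 := Polynomial.eraseLead_natDegree_lt_or_eraseLead_eq_zero q
          rw [← hr] at h2
          rcases h2 with h2 | h2
          · omega
          · rw [h2, Polynomial.natDegree_zero] at h; omega)]
      refine lt_of_le_of_lt (totalDegree_finsetSum_le fun i hi => ?_) (?_ : (r - 1) * P.totalDegree + 0 < _)
      · rw [Finset.mem_range] at hi
        calc (q.eraseLead.coeff i • P ^ i).totalDegree ≤ (P ^ i).totalDegree := totalDegree_smul_le _ _
          _ = i * P.totalDegree := totalDegree_pow_eq P hP0 i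
          _ ≤ (r - 1) * P.totalDegree + 0 := by
              rw [add_zero]; exact Nat.mul_le_mul_right _ (by omega)
      · rw [add_zero]
        have : (r - 1) * P.totalDegree < r * P.totalDegree :=
          Nat.mul_lt_mul_of_pos_right (by omega) hP
        exact this
    intro h0
    rw [hsplit] at h0
    have hdeg := totalDegree_add_eq_left_of_totalDegree_lt hrest
    rw [h0, totalDegree_zero, hlead] at hdeg
    have : 0 < r * P.totalDegree := Nat.mul_pos (by omega) hP
    omega

/-! ### `Δ_1(P) ≠ 0` -/

/-- **`Δ_1(P) ≠ 0` for non-constant `P`** (characteristic `0`): otherwise all `y_j`-coefficients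
`c_{ℓ,δ_j}` of every `P_ℓ(z+y)` vanish, and Euler's identity `ℓ P_ℓ = Σ_j z_j c_{ℓ,δ_j}` kills every
`P_ℓ`, `ℓ ≥ 1`. [cite: GuoKumarSaptharishiSolomon2019, Obs. 22 (arXiv p0010.txt:L53-55)] -/
theorem homogeneousComponent_one_shiftR_ne_zero [CharZero F] {P : MvPolynomial (Fin k) F}
    (hP : 0 < P.totalDegree) : homogeneousComponent 1 (shiftR P) ≠ 0 := by
  classical
  intro hΛ
  -- all `c_{ℓ, δ_j} = 0`
  set N := P.totalDegree + 1 with hN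
  have hPsum : P = ∑ ℓ ∈ Finset.range N, homogeneousComponent ℓ P :=
    (sum_homogeneousComponent (φ := P)).symm
  have hcoef : ∀ j : Fin k, ∀ ℓ, 1 ≤ ℓ →
      coeff (Finsupp.single j 1) (shiftR (homogeneousComponent ℓ P)) = 0 := by
    intro j ℓ₀ hℓ₀
    -- the `y_j`-coefficient of `P(z+y)` is `Σ_ℓ c_{ℓ,δ_j}` and vanishes
    have hsum : ∑ ℓ ∈ Finset.range N,
        coeff (Finsupp.single j 1) (shiftR (homogeneousComponent ℓ P)) = 0 := by
      have h1 : coeff (Finsupp.single j 1) (shiftR P) = 0 := by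
        have := congrArg (coeff (Finsupp.single j 1)) hΛ
        rwa [coeff_homogeneousComponent, Finsupp.degree_single, if_pos rfl, coeff_zero] at this
      conv_lhs at h1 => rw [hPsum, shiftR_apply, map_sum, coeff_sum]
      simp_rw [← shiftR_apply] at h1
      exact h1
    -- each summand is homogeneous of degree `ℓ - 1`; project to degree `ℓ₀ - 1`
    have hproj := congrArg (homogeneousComponent (ℓ₀ - 1)) hsum
    rw [map_sum, map_zero] at hproj
    rw [Finset.sum_eq_single ℓ₀] at hproj
    · rwa [homogeneousComponent_of_mem ((mem_homogeneousSubmodule _ _).mpr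
        (isHomogeneous_coeff_shiftR (homogeneousComponent_isHomogeneous ℓ₀ P) _)),
        Finsupp.degree_single, if_pos rfl] at hproj
    · intro ℓ _ hne
      by_cases hℓ : ℓ = 0
      · subst hℓ
        rw [coeff_shiftR_eq_zero_of_lt (homogeneousComponent_isHomogeneous 0 P)
          (by rw [Finsupp.degree_single]; omega), map_zero]
      · rw [homogeneousComponent_of_mem ((mem_homogeneousSubmodule _ _).mpr
          (isHomogeneous_coeff_shiftR (homogeneousComponent_isHomogeneous ℓ P) _)),
          Finsupp.degree_single, if_neg (by omega)]
    · intro hℓ₀N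
      rw [Finset.mem_range, not_lt] at hℓ₀N
      rw [homogeneousComponent_eq_zero _ P (by omega), shiftR_apply, map_zero, coeff_zero, map_zero]
  -- Euler: `ℓ P_ℓ = 0`, so `P_ℓ = 0` for `ℓ ≥ 1`
  have hPℓ : ∀ ℓ, 1 ≤ ℓ → homogeneousComponent ℓ P = 0 := by
    intro ℓ hℓ
    have heu := euler_coeff_shiftR (homogeneousComponent_isHomogeneous ℓ P) 0
    rw [Finset.sum_eq_zero (fun j _ => by rw [zero_add, hcoef j ℓ hℓ, mul_zero, mul_zero]),
      map_zero, Nat.sub_zero, coeff_zero_shiftR] at heu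
    have hℓne : ((ℓ : ℕ) : MvPolynomial (Fin k) F) ≠ 0 := Nat.cast_ne_zero.mpr (by omega)
    exact (mul_eq_zero.mp heu.symm).resolve_left hℓne
  -- hence `P = P_0` is constant
  have hP0 : P = homogeneousComponent 0 P := by
    conv_lhs => rw [hPsum]
    rw [Finset.sum_eq_single 0 (fun ℓ _ hℓ => hPℓ ℓ (by omega)) (fun h => absurd (by simp [hN]) h)]
  have := (homogeneousComponent_isHomogeneous 0 P).totalDegree_le
  rw [← hP0] at this
  omega

/-! ### The low-variable injectivity -/

/-- The core (`m = 1`): `Q(P, Δ_1(P)) = 0 ⇒ Q = 0` in `R[y]`, by the `y`-grading (the degree-`b`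
part of `Q(P, Λ)` is `q_b(P) · Λ^b`) and transcendence of `P`.
[cite: GuoKumarSaptharishiSolomon2019, Obs. 22 (arXiv p0010.txt:L53-55) and §3 (p0011.txt:L13)] -/
theorem aeval_genR_one_injective [CharZero F] {P : MvPolynomial (Fin k) F} (hP : 0 < P.totalDegree)
    (Q : MvPolynomial (Fin 2) F)
    (h : aeval (fun i : Fin 2 => homogeneousComponent (i : ℕ) (shiftR P)) Q = 0) : Q = 0 := by
  classical
  set Λ := homogeneousComponent 1 (shiftR P) with hΛ
  have hΛne : Λ ≠ 0 := homogeneousComponent_one_shiftR_ne_zero hP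
  have hΛhom : Λ.IsHomogeneous 1 := homogeneousComponent_isHomogeneous 1 _
  -- `aeval = Σ_s C(c_s • P^{s 0}) * Λ^{s 1}`
  have hexp : aeval (fun i : Fin 2 => homogeneousComponent (i : ℕ) (shiftR P)) Q =
      ∑ s ∈ Q.support, C (coeff s Q • P ^ (s 0)) * Λ ^ (s 1) := by
    rw [aeval_eq_eval₂Hom, coe_eval₂Hom, eval₂_eq']
    refine Finset.sum_congr rfl fun s _ => ?_
    rw [Fin.prod_univ_two]
    simp only [Fin.val_zero, Fin.val_one, homogeneousComponent_zero_shiftR, ← hΛ]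
    rw [MvPolynomial.algebraMap_apply, MvPolynomial.algebraMap_eq, smul_eq_C_mul, map_mul, map_pow,
      mul_assoc]
  -- the degree-`b` part
  have hcomp : ∀ b : ℕ, homogeneousComponent b
      (aeval (fun i : Fin 2 => homogeneousComponent (i : ℕ) (shiftR P)) Q) =
      C (∑ s ∈ Q.support with s 1 = b, coeff s Q • P ^ (s 0)) * Λ ^ b := by
    intro b
    rw [hexp, map_sum, map_sum, Finset.sum_mul, Finset.sum_filter]
    refine Finset.sum_congr rfl fun s _ => ?_
    have hhom : (C (coeff s Q • P ^ (s 0)) * Λ ^ (s 1)).IsHomogeneous (s 1) := by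
      have := (isHomogeneous_C _ (coeff s Q • P ^ (s 0))).mul (hΛhom.pow (s 1))
      simpa using this
    rw [homogeneousComponent_of_mem hhom]
    by_cases hb : s 1 = b
    · subst hb; simp
    · rw [if_neg (Ne.symm hb), if_neg hb]
  -- each `q_b(P) = 0`, hence `q_b = 0`
  have hq : ∀ b : ℕ, (∑ s ∈ Q.support with s 1 = b,
      Polynomial.monomial (s 0) (coeff s Q) : Polynomial F) = 0 := by
    intro b
    by_contra hne
    have hval : Polynomial.aeval P (∑ s ∈ Q.support with s 1 = b,
        Polynomial.monomial (s 0) (coeff s Q) : Polynomial F) =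
        ∑ s ∈ Q.support with s 1 = b, coeff s Q • P ^ (s 0) := by
      rw [map_sum]
      refine Finset.sum_congr rfl fun s _ => ?_
      rw [Polynomial.aeval_monomial, MvPolynomial.algebraMap_eq, smul_eq_C_mul]
    have h0 := hcomp b
    rw [h, map_zero] at h0
    have hC : C (∑ s ∈ Q.support with s 1 = b, coeff s Q • P ^ (s 0)) = (0 : MvPolynomial (Fin k)
        (MvPolynomial (Fin k) F)) := by
      rcases mul_eq_zero.mp h0.symm with h1 | h1
      · exact h1
      · exact absurd h1 (pow_ne_zero _ hΛne)
    rw [C_eq_zero, ← hval] at hC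
    exact aeval_ne_zero_of_totalDegree_pos hP hne hC
  -- read off the coefficients
  ext s
  rw [coeff_zero]
  by_contra hs
  have hmem : s ∈ Q.support := mem_support_iff.mpr hs
  have := congrArg (fun p : Polynomial F => p.coeff (s 0)) (hq (s 1))
  simp only [Polynomial.finsetSum_coeff, Polynomial.coeff_monomial, Polynomial.coeff_zero] at this
  rw [Finset.sum_eq_single s] at this
  · simp at this; exact hs this
  · intro s' hs' hne
    rw [Finset.mem_filter] at hs'
    rw [if_neg]
    intro h0
    apply hne
    ext i
    fin_cases i
    · exact h0
    · exact hs'.2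
  · intro hns
    exact absurd (Finset.mem_filter.mpr ⟨hmem, rfl⟩ :
      s ∈ Q.support.filter (fun s' => s' 1 = s 1)) hns

/-- **The low-variable case of Theorem 1.6.** For `m ≤ 1` and non-constant `P` (`char F = 0`),
`Q(Δ_0(P), …, Δ_m(P)) = 0` forces `Q = 0` — so `G_P^{≤ n}` is a generator for ALL of
`F[x_0, …, x_n]` when `n ≤ 1`. [cite: GuoKumarSaptharishiSolomon2019, Obs. 22 (arXiv p0010.txt:L53-55) and §3 (p0011.txt:L13)] -/
theorem lowVariables (F : Type) [Field F] [CharZero F] (k m : ℕ) (hm : m ≤ 1)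
    (P : MvPolynomial (Fin k) F) (hP : 0 < P.totalDegree) (Q : MvPolynomial (Fin (m + 1)) F)
    (h : aeval (gen P m) Q = 0) : Q = 0 := by
  classical
  have hR : aeval (fun i : Fin (m + 1) => homogeneousComponent (i : ℕ) (shiftR P)) Q = 0 := by
    rw [← bind₁_gen_eq_zero_iff, ← aeval_eq_bind₁]; exact h
  -- embed into two variables
  have hle : m + 1 ≤ 2 := by omega
  set ι : Fin (m + 1) → Fin 2 := Fin.castLE hle with hι
  have hQ2 : aeval (fun i : Fin 2 => homogeneousComponent (i : ℕ) (shiftR P)) (rename ι Q) = 0 := by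
    rw [aeval_rename]
    have : (fun i : Fin 2 => homogeneousComponent (i : ℕ) (shiftR P)) ∘ ι =
        fun i : Fin (m + 1) => homogeneousComponent (i : ℕ) (shiftR P) := by
      funext i; simp [hι]
    rw [this, hR]
  have := aeval_genR_one_injective hP (rename ι Q) hQ2
  exact rename_injective ι (Fin.castLE_injective hle) (by rw [this, map_zero])

end GKSS2019

end Literature.Computability.AlgebraicComplexity
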